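import Summits.Ventures.Crystal3D.Theorems.StickyWulffConstantPolycrystalWulffBoundRungZoneTexture
import Summits.Ventures.Crystal3D.Theorems.StickyWulffConstantPolycrystalWulffBoundMinkowskiUpper
import Summits.Ventures.Crystal3D.Theorems.StickyWulffConstantPolycrystalWulffBoundPolyClosure

/-!
# `PolycrystalWulffBound`, line `PolyDensity`: the vertical rung in TEXTURE form — single-axis twin
# textures whose lattice is a function of the height along a horizontal direction `n` satisfy the
# polycrystal Wulff bound (crux energy, law `(1, 1/2)`)

Route `StickyWulffConstant` of the venture `Summits/Ventures/Crystal3D`, crux `PolycrystalWulffBound`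
(item `stmt-Ventures-19482`), second prover lane (poly-p2, gen 8).  `rung_verticalLamellar`
(`…RungVerticalLamellar`) treats ONE polyhedral set cut by parallel planes containing the axis.  Here the
grains are arbitrary polyhedral sets and the hypothesis is only that grains met by one plane
`{⟪x, n⟫ = t}` (`n ⊥ m` a unit vector) carry the same lattice — every twin wall is a piece of a plane
`⊥ n`, i.e. a VERTICAL wall of normal `n` (any azimuth `n ⊥ m`; the incoherent Σ3 `{112}` and `{110}`
walls):
* `layer_chimera_lower` — the chimera lower bound `|⋃ G_f|^{1/3} + r·32^{1/3} ≤ |C|^{1/3}` (engine: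
  the SL line's `Chimera.chimera3_brunnMinkowski`; bodies `B₀`, `R_m B₀` have sections `⊥ n` of equal
  area because `R_m` fixes `n`);
* `rung_vertical` — FREE energy alone `≥ 6·2^{1/3}(√2·Vol)^{2/3}` (let-vocabulary);
* **`rung_vertical_texture`** — the same in the crux's `Tex`/`En` vocabulary for arbitrary wall data.
WHAT THIS IS NOT: a registered stub; inclined walls; the crux is not claimed. -/

noncomputable section

open scoped BigOperators InnerProductSpace ENNReal Pointwise
open MeasureTheory Filter Set

namespace Summit.Ventures.Crystal3D.Theorems

open Summit.Ventures.Crystal3D.Cruxes.TextureLiminf.TexShadow (E3)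
open Literature.MathematicalPhysics.StatisticalMechanics (fccStacking barlowStacking IsHaggSeq)

/-- **Chimera lower bound for single-axis twin textures layered along a horizontal `n`.**  Grains `G_f`
(measurable) with frames pairwise satisfying `Ax m`, `n ⊥ m` a unit vector, grains met by one plane
`⊥ n` carrying the same lattice; if a measurable `C` contains `x + r·w` for all `x ∈ G_f`, `w ∈ W(A_f)`
(`r > 0`) and `0 < |⋃ G_f| < ∞`, then `|⋃ G_f|^{1/3} + r·32^{1/3} ≤ |C|^{1/3}`. -/
theorem layer_chimera_lower (m n : E3) (hn : ‖n‖ = 1) (hmn : ⟪m, n⟫_ℝ = 0)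
    {k : ℕ} (G : Fin k → Set E3) (hG : ∀ f, MeasurableSet (G f)) (A : Fin k → (E3 ≃ₗᵢ[ℝ] E3))
    (hAx : ∀ f g, ∃ (L : E3 ≃ₗᵢ[ℝ] E3) (s₁ s₂ : E3) (σ σ' : ℤ → ℤ), IsHaggSeq σ ∧ IsHaggSeq σ' ∧
      L (EuclideanSpace.single (2 : Fin 3) (1 : ℝ)) = m ∧
      A f '' fccStacking 1 (Real.sqrt (2 / 3)) ⊆
        (fun q => L q + s₁) '' barlowStacking 1 (Real.sqrt (2 / 3)) σ ∧
      A g '' fccStacking 1 (Real.sqrt (2 / 3)) ⊆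
        (fun q => L q + s₂) '' barlowStacking 1 (Real.sqrt (2 / 3)) σ')
    (hlayer : ∀ f g, ∀ x ∈ G f, ∀ y ∈ G g, ⟪x, n⟫_ℝ = ⟪y, n⟫_ℝ →
      A f '' fccStacking 1 (Real.sqrt (2 / 3)) = A g '' fccStacking 1 (Real.sqrt (2 / 3)))
    (h0 : volume (⋃ f : Fin k, G f) ≠ 0) (htop : volume (⋃ f : Fin k, G f) ≠ ⊤)
    {r : ℝ} (hr : 0 < r) {C : Set E3} (hC : MeasurableSet C)
    (hsub : ∀ f, ∀ x ∈ G f,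
      ∀ w ∈ {y : E3 | ∀ ν : E3, ⟪y, ν⟫_ℝ ≤ Real.sqrt 2 / 4 *
        ∑ᶠ w ∈ {w | w ∈ fccStacking 1 (Real.sqrt (2 / 3)) ∧ ‖w‖ = 1}, |⟪w, (A f).symm ν⟫_ℝ|},
      x + r • w ∈ C) :
    volume (⋃ f : Fin k, G f) ^ ((3 : ℕ)⁻¹ : ℝ) +
        ENNReal.ofReal r * (ENNReal.ofReal 32) ^ ((3 : ℕ)⁻¹ : ℝ) ≤ volume C ^ ((3 : ℕ)⁻¹ : ℝ) := by
  classical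
  set e₂ : E3 := EuclideanSpace.single (2 : Fin 3) (1 : ℝ) with he₂
  set E' : Set E3 := ⋃ f : Fin k, G f with hE'
  -- a grain is occupied; its body is the reference body `B₀`
  obtain ⟨x₀, hx₀⟩ := nonempty_of_measure_ne_zero h0
  obtain ⟨f₀, -⟩ := mem_iUnion.1 hx₀
  set B₀ : Set E3 := {y : E3 | ∀ ν : E3, ⟪y, ν⟫_ℝ ≤ Real.sqrt 2 / 4 *
    ∑ᶠ w ∈ {w | w ∈ fccStacking 1 (Real.sqrt (2 / 3)) ∧ ‖w‖ = 1}, |⟪w, (A f₀).symm ν⟫_ℝ|} with hB₀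
  -- `m` is a unit vector (it is the image of `e₂` under a frame)
  have he : ‖e₂‖ = 1 := by rw [he₂, PiLp.norm_single, norm_one]
  have hm : ‖m‖ = 1 := by
    obtain ⟨L, -, -, -, -, -, -, hLm, -, -⟩ := hAx f₀ f₀
    rw [← hLm, LinearIsometryEquiv.norm_map, he]
  set Rm : E3 ≃ₗᵢ[ℝ] E3 := (ℝ ∙ m)ᗮ.reflection with hRm
  have hRmn : Rm n = n := reflection_orthogonal_unit_of_inner_eq_zero hm hmn
  -- a frame `L₀` with `L₀ e₂ = n`
  set L₀ : E3 ≃ₗᵢ[ℝ] E3 := (ℝ ∙ (e₂ - n))ᗮ.reflection with hL₀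
  have hL₀n : L₀ e₂ = n := Submodule.reflection_sub (by rw [he, hn])
  have hL₀symm : L₀.symm n = e₂ := by rw [← hL₀n, LinearIsometryEquiv.symm_apply_apply]
  -- the transport `T = coords ∘ L₀⁻¹`
  set meq : E3 ≃ᵐ (Fin 3 → ℝ) := (MeasurableEquiv.toLp 2 (Fin 3 → ℝ)).symm with hmeq
  set T : E3 ≃ᵐ (Fin 3 → ℝ) := L₀.symm.toHomeomorph.toMeasurableEquiv.trans meq with hT
  have hTapply : ∀ x, T x = meq (L₀.symm x) := fun x => rfl
  have hTmp : MeasurePreserving T volume volume :=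
    L₀.symm.measurePreserving.trans (EuclideanSpace.volume_preserving_symm_measurableEquiv_toLp (Fin 3))
  have hmeq_mp : MeasurePreserving meq volume volume :=
    EuclideanSpace.volume_preserving_symm_measurableEquiv_toLp (Fin 3)
  have hTvol : ∀ X : Set E3, MeasurableSet X → volume (T '' X) = volume X := fun X hX => by
    rw [MeasurableEquiv.image_eq_preimage_symm]
    exact hTmp.symm.measure_preimage hX.nullMeasurableSet
  have hT2 : ∀ x : E3, (T x) 2 = ⟪x, n⟫_ℝ := by
    intro x
    rw [hTapply]
    show (L₀.symm x) 2 = ⟪x, n⟫_ℝ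
    have h1 : (L₀.symm x) 2 = ⟪L₀.symm x, e₂⟫_ℝ := by
      rw [he₂, EuclideanSpace.inner_single_right]; simp
    rw [h1, ← hL₀symm, LinearIsometryEquiv.inner_map_map]
  have hTadd : ∀ x y : E3, T (x + y) = T x + T y := fun x y => by
    rw [hTapply, hTapply, hTapply, map_add]; rfl
  have hTimage : ∀ X : Set E3, T '' X = meq '' (L₀.symm '' X) := fun X => by
    rw [← Set.image_comp]; rfl
  -- every body is `B₀` or its mirror image
  have hbody : ∀ f, {y : E3 | ∀ ν : E3, ⟪y, ν⟫_ℝ ≤ Real.sqrt 2 / 4 *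
      ∑ᶠ w ∈ {w | w ∈ fccStacking 1 (Real.sqrt (2 / 3)) ∧ ‖w‖ = 1}, |⟪w, (A f).symm ν⟫_ℝ|} = B₀ ∨
      {y : E3 | ∀ ν : E3, ⟪y, ν⟫_ℝ ≤ Real.sqrt 2 / 4 *
      ∑ᶠ w ∈ {w | w ∈ fccStacking 1 (Real.sqrt (2 / 3)) ∧ ‖w‖ = 1}, |⟪w, (A f).symm ν⟫_ℝ|} = Rm '' B₀ :=
    fun f => cruxWulffBody_eq_or_eq_reflection_image (hAx f₀ f)
  -- the reference body in transported coordinates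
  have hB₀c : IsCompact B₀ := isCompact_cruxWulffBody _
  set S : Set E3 := L₀.symm '' (r • B₀) with hSdef
  have hrB₀m : MeasurableSet (r • B₀) := (hB₀c.smul r).isClosed.measurableSet
  have hS : MeasurableSet S := by
    rw [hSdef, LinearIsometryEquiv.image_eq_preimage_symm]
    exact hrB₀m.preimage L₀.symm.symm.continuous.measurable
  have hrB : -(r • B₀) = r • B₀ := by rw [← Set.smul_set_neg, hB₀, neg_cruxWulffBody_eq]
  have hSsymm : -S = S := by
    ext y
    rw [Set.mem_neg, hSdef, mem_image, mem_image]
    constructor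
    · rintro ⟨x, hx, hxy⟩
      refine ⟨-x, ?_, ?_⟩
      · rw [← hrB]; exact Set.neg_mem_neg.2 hx
      · rw [map_neg, hxy, neg_neg]
    · rintro ⟨x, hx, rfl⟩
      exact ⟨-x, by rw [← hrB]; exact Set.neg_mem_neg.2 hx, by rw [map_neg]⟩
  -- the mirror in transported coordinates fixes the vertical axis
  set N : E3 ≃ₗᵢ[ℝ] E3 := L₀.trans (Rm.trans L₀.symm) with hN
  have hNapply : ∀ x, N x = L₀.symm (Rm (L₀ x)) := fun x => rfl
  have hNe : N e₂ = (1 : ℝ) • e₂ := by rw [hNapply, hL₀n, hRmn, hL₀symm, one_smul]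
  -- transported bodies: `meq '' S` or `meq '' (N '' S)`
  have hbodyT : ∀ f, T '' (r • {y : E3 | ∀ ν : E3, ⟪y, ν⟫_ℝ ≤ Real.sqrt 2 / 4 *
      ∑ᶠ w ∈ {w | w ∈ fccStacking 1 (Real.sqrt (2 / 3)) ∧ ‖w‖ = 1}, |⟪w, (A f).symm ν⟫_ℝ|}) = meq '' S ∨
      T '' (r • {y : E3 | ∀ ν : E3, ⟪y, ν⟫_ℝ ≤ Real.sqrt 2 / 4 *
      ∑ᶠ w ∈ {w | w ∈ fccStacking 1 (Real.sqrt (2 / 3)) ∧ ‖w‖ = 1}, |⟪w, (A f).symm ν⟫_ℝ|}) =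
        meq '' (N '' S) := by
    intro f
    rcases hbody f with h | h
    · left
      rw [h, hTimage]
    · right
      rw [h, hTimage]
      congr 1
      ext z
      simp only [mem_image, hNapply, hSdef]
      constructor
      · rintro ⟨y, hy, rfl⟩
        obtain ⟨y', hy', rfl⟩ := Set.mem_smul_set.1 hy
        obtain ⟨b, hb, rfl⟩ := hy'
        refine ⟨L₀.symm (r • b), ⟨r • b, Set.smul_mem_smul_set hb, rfl⟩, ?_⟩
        rw [LinearIsometryEquiv.apply_symm_apply, map_smul]
      · rintro ⟨_, ⟨y, hy, rfl⟩, rfl⟩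
        obtain ⟨b, hb, rfl⟩ := Set.mem_smul_set.1 hy
        refine ⟨r • Rm b, Set.smul_mem_smul_set ⟨b, hb, rfl⟩, ?_⟩
        simp only [LinearIsometryEquiv.apply_symm_apply, map_smul]
  have hslice_eq : ∀ f u, volume {p : ℝ × ℝ | (![p.1, p.2, u] : Fin 3 → ℝ) ∈
      T '' (r • {y : E3 | ∀ ν : E3, ⟪y, ν⟫_ℝ ≤ Real.sqrt 2 / 4 *
        ∑ᶠ w ∈ {w | w ∈ fccStacking 1 (Real.sqrt (2 / 3)) ∧ ‖w‖ = 1}, |⟪w, (A f).symm ν⟫_ℝ|})} =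
      volume {p : ℝ × ℝ | (![p.1, p.2, u] : Fin 3 → ℝ) ∈ meq '' S} := by
    intro f u
    rcases hbodyT f with h | h
    · rw [h]
    · rw [h]
      exact volume_slice3_image_eq N (Or.inl rfl) hNe hS hSsymm u
  -- the height profile: the body of the grains at height `t`
  set g : ℝ → Fin k := fun t =>
    if h : ∃ f : Fin k, ∃ y ∈ G f, ⟪y, n⟫_ℝ = t then h.choose else f₀ with hg
  have hg_eq : ∀ f, ∀ x ∈ G f,
      {y : E3 | ∀ ν : E3, ⟪y, ν⟫_ℝ ≤ Real.sqrt 2 / 4 *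
        ∑ᶠ w ∈ {w | w ∈ fccStacking 1 (Real.sqrt (2 / 3)) ∧ ‖w‖ = 1}, |⟪w, (A (g ⟪x, n⟫_ℝ)).symm ν⟫_ℝ|} =
      {y : E3 | ∀ ν : E3, ⟪y, ν⟫_ℝ ≤ Real.sqrt 2 / 4 *
        ∑ᶠ w ∈ {w | w ∈ fccStacking 1 (Real.sqrt (2 / 3)) ∧ ‖w‖ = 1}, |⟪w, (A f).symm ν⟫_ℝ|} := by
    intro f x hx
    have hex : ∃ f' : Fin k, ∃ y ∈ G f', ⟪y, n⟫_ℝ = ⟪x, n⟫_ℝ := ⟨f, x, hx, rfl⟩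
    have h1 : g ⟪x, n⟫_ℝ = hex.choose := by simp only [hg, dif_pos hex]
    rw [h1]
    obtain ⟨y, hy, hyx⟩ := hex.choose_spec
    exact wulffBody_eq_of_image_eq (hlayer _ _ y hy x hx hyx)
  -- the chimera inequality in the transported coordinates
  set Wt : ℝ → Set (Fin 3 → ℝ) := fun t => T '' (r • {y : E3 | ∀ ν : E3, ⟪y, ν⟫_ℝ ≤ Real.sqrt 2 / 4 *
    ∑ᶠ w ∈ {w | w ∈ fccStacking 1 (Real.sqrt (2 / 3)) ∧ ‖w‖ = 1}, |⟪w, (A (g t)).symm ν⟫_ℝ|}) with hWt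
  set W₀ : Set (Fin 3 → ℝ) := meq '' S with hW₀
  have hE'm : MeasurableSet E' := MeasurableSet.iUnion hG
  have hbodym : ∀ f, MeasurableSet (r • {y : E3 | ∀ ν : E3, ⟪y, ν⟫_ℝ ≤ Real.sqrt 2 / 4 *
      ∑ᶠ w ∈ {w | w ∈ fccStacking 1 (Real.sqrt (2 / 3)) ∧ ‖w‖ = 1}, |⟪w, (A f).symm ν⟫_ℝ|}) :=
    fun f => ((isCompact_cruxWulffBody (A f)).smul r).isClosed.measurableSet
  have hvS : volume S = ENNReal.ofReal (r ^ 3) * ENNReal.ofReal 32 := by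
    rw [hSdef, LinearIsometryEquiv.image_eq_preimage_symm,
      L₀.symm.symm.measurePreserving.measure_preimage hrB₀m.nullMeasurableSet,
      Measure.addHaar_smul, finrank_euclideanSpace, Fintype.card_fin, hB₀, volume_cruxWulffBody,
      abs_of_pos (pow_pos hr 3)]
  have hvW₀ : volume W₀ = ENNReal.ofReal (r ^ 3) * ENNReal.ofReal 32 := by
    rw [hW₀, MeasurableEquiv.image_eq_preimage_symm, hmeq_mp.symm.measure_preimage hS.nullMeasurableSet,
      hvS]
  have hchim := Chimera.chimera3_brunnMinkowski (A := T '' E') (C := T '' C) (W₀ := W₀) Wt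
    ((MeasurableEquiv.measurableSet_image _).2 hE'm) ((MeasurableEquiv.measurableSet_image _).2 hC)
    ((MeasurableEquiv.measurableSet_image _).2 hS)
    (fun t => (MeasurableEquiv.measurableSet_image _).2 (hbodym _))
    (fun t u => (hslice_eq (g t) u).symm.le)
    (by
      rintro z ⟨x, hx, rfl⟩ w hw
      obtain ⟨f, hxf⟩ := mem_iUnion.1 hx
      have hw' : w ∈ T '' (r • {y : E3 | ∀ ν : E3, ⟪y, ν⟫_ℝ ≤ Real.sqrt 2 / 4 *
          ∑ᶠ w ∈ {w | w ∈ fccStacking 1 (Real.sqrt (2 / 3)) ∧ ‖w‖ = 1}, |⟪w, (A f).symm ν⟫_ℝ|}) := by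
        rw [← hg_eq f x hxf, ← hT2 x]; exact hw
      obtain ⟨v, hv, rfl⟩ := hw'
      obtain ⟨w', hw'1, rfl⟩ := Set.mem_smul_set.1 hv
      refine ⟨x + r • w', hsub f x hxf w' hw'1, ?_⟩
      rw [hTadd])
    (by rw [hTvol _ hE'm]; exact h0) (by rw [hTvol _ hE'm]; exact htop)
    (by
      rw [hvW₀]
      exact mul_ne_zero (ENNReal.ofReal_pos.2 (by positivity)).ne' (ENNReal.ofReal_pos.2 (by norm_num)).ne')
    (by
      rw [hvW₀]
      exact ENNReal.mul_ne_top ENNReal.ofReal_ne_top ENNReal.ofReal_ne_top)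
  -- read off the volumes
  have hroot : (ENNReal.ofReal (r ^ 3) * ENNReal.ofReal 32) ^ ((3 : ℕ)⁻¹ : ℝ) =
      ENNReal.ofReal r * ENNReal.ofReal 32 ^ ((3 : ℕ)⁻¹ : ℝ) := by
    rw [ENNReal.mul_rpow_of_nonneg _ _ (by positivity), ENNReal.ofReal_rpow_of_nonneg (by positivity)
      (by positivity), Real.pow_rpow_inv_natCast hr.le (by norm_num)]
  rw [hTvol _ hE'm, hTvol _ hC, hvW₀, hroot] at hchim
  exact hchim

end Summit.Ventures.Crystal3D.Theorems

namespace Summit.Ventures.Crystal3D.Cruxes.PolycrystalWulffBound.PolyDensity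

open Summit.Ventures.Crystal3D.Theorems
open Summit.Ventures.Crystal3D.Cruxes.TextureLiminf.TexShadow (per polytope E3)
open Literature.MathematicalPhysics.StatisticalMechanics (fccStacking barlowStacking IsHaggSeq perimeter)

/-- **Rung `rung_vertical`** (let-vocabulary of the planner's rungs): single-axis twin textures of
polyhedral grains whose lattice is a function of the height along a horizontal unit vector `n ⊥ m`
(all twin walls vertical of normal `n`) satisfy the polycrystal Wulff bound with the FREE energy alone. -/
theorem rung_vertical : let Λ : Set (EuclideanSpace ℝ (Fin 3)) := Literature.MathematicalPhysics.StatisticalMechanics.fccStacking 1 (Real.sqrt (2 / 3)); let Brl : (ℤ → ℤ) → Set (EuclideanSpace ℝ (Fin 3)) := Literature.MathematicalPhysics.StatisticalMechanics.barlowStacking 1 (Real.sqrt (2 / 3)); let Ax : EuclideanSpace ℝ (Fin 3) → (EuclideanSpace ℝ (Fin 3) ≃ₗᵢ[ℝ] EuclideanSpace ℝ (Fin 3)) → (EuclideanSpace ℝ (Fin 3) ≃ₗᵢ[ℝ] EuclideanSpace ℝ (Fin 3)) → Prop := fun m A B => ∃ (L : EuclideanSpace ℝ (Fin 3) ≃ₗᵢ[ℝ]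 EuclideanSpace ℝ (Fin 3)) (s₁ s₂ : EuclideanSpace ℝ (Fin 3)) (σ σ' : ℤ → ℤ), Literature.MathematicalPhysics.StatisticalMechanics.IsHaggSeq σ ∧ Literature.MathematicalPhysics.StatisticalMechanics.IsHaggSeq σ' ∧ L (EuclideanSpace.single (2 : Fin 3) (1 : ℝ)) = m ∧ A '' Λ ⊆ (fun q => L q + s₁) '' Brl σ ∧ B '' Λ ⊆ (fun q => L q + s₂) '' Brl σ'; let Φ : EuclideanSpace ℝ (Fin 3) → ℝ := fun ν => Real.sqrt 2 / 4 * ∑ᶠ w ∈ {w ∈ Λ | ‖w‖ = 1}, |⟪w, ν⟫_ℝ|; let Per : Set (EuclideanSpace ℝ (Fin 3)) → Set (EuclideanSpace ℝ (Fin 3)) → ℝ := fun K S => (⨆ (ξ : EuclideanSpace ℝ (Fin 3) → EuclideanSpace ℝ (Fin 3)) (_ : ContDiff ℝ 1 ξ ∧ HasCompactSupport ξ ∧ ∀ z, ξ z ∈ K), ENNReal.ofReal (∫ z in S, Literature.MathematicalPhysics.StatisticalMechanics.fieldDivergence ξ z)).toReal; let ι : Set (EuclideanSpace ℝ (Fin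 3)) → Set (EuclideanSpace ℝ (Fin 3)) → Set (EuclideanSpace ℝ (Fin 3)) → ℝ := fun K S₁ S₂ => (Per K S₁ + Per K S₂ - Per K (S₁ ∪ S₂)) / 2; let W : (EuclideanSpace ℝ (Fin 3) ≃ₗᵢ[ℝ] EuclideanSpace ℝ (Fin 3)) → Set (EuclideanSpace ℝ (Fin 3)) := fun A => {y | ∀ ν : EuclideanSpace ℝ (Fin 3), ⟪y, ν⟫_ℝ ≤ Φ (A.symm ν)}; let Vol : (n : ℕ) → (Fin n → Set (EuclideanSpace ℝ (Fin 3))) → ℝ := fun n G => (volume (⋃ f : Fin n, G f)).toReal; let Poly : Set (EuclideanSpace ℝ (Fin 3)) → Prop := fun S => ∃ (k : ℕ) (H : Fin k → Finset ((EuclideanSpace ℝ (Fin 3)) × ℝ)), S = ⋃ i, ⋂ p ∈ H i, {x | ⟪p.1, x⟫_ℝ < p.2}; let Fr : (n : ℕ) → (Fin n → Set (EuclideanSpace ℝ (Fin 3))) → (Fin n → (EuclideanSpace ℝ (Fin 3) ≃ₗᵢ[ℝ] EuclideanSpace ℝ (Fin 3))) → ℝ := fun n G A => ∑ f : Fin n,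 Per (W (A f)) (G f) - ∑ f, ∑ g, (if f = g then 0 else ι (W (A f)) (G f) (G g)); ∀ (k : ℕ) (G : Fin k → Set (EuclideanSpace ℝ (Fin 3))) (A : Fin k → (EuclideanSpace ℝ (Fin 3) ≃ₗᵢ[ℝ] EuclideanSpace ℝ (Fin 3))) (m n : EuclideanSpace ℝ (Fin 3)), (∀ f, Poly (G f)) → (∀ f, volume (G f) < ⊤) → (∀ f g, f ≠ g → Disjoint (G f) (G g)) → (∀ f g, Ax m (A f) (A g)) → ‖n‖ = 1 → ⟪m, n⟫_ℝ = 0 → (∀ f g, ∀ x ∈ G f, ∀ y ∈ G g, ⟪x, n⟫_ℝ = ⟪y, n⟫_ℝ → A f '' Λ = A g '' Λ) → 6 * (2 : ℝ) ^ ((1 : ℝ) / 3) * (Real.sqrt 2 * Vol k G) ^ ((2 : ℝ) / 3) ≤ Fr k G A := by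
  intro Λ Brl Ax Φ Per ι W Vol Poly Fr k G A m n hPoly hvolG hdisjG hAx hn hmn hlayer
  classical
  show 6 * (2 : ℝ) ^ ((1 : ℝ) / 3) * (Real.sqrt 2 * (volume (⋃ f, G f)).toReal) ^ ((2 : ℝ) / 3) ≤
    (∑ f, Per (W (A f)) (G f)) - ∑ f, ∑ g, (if f = g then 0 else ι (W (A f)) (G f) (G g))
  rw [← Finset.sum_sub_distrib]
  have hPolyG : ∀ f, ∃ (k : ℕ) (H : Fin k → Finset (E3 × ℝ)), G f = ⋃ i, polytope (H i) := hPoly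
  -- bodies
  have hWc : ∀ f, IsCompact (W (A f)) := fun f => isCompact_cruxWulffBody (A f)
  have hWv : ∀ f, Convex ℝ (W (A f)) := fun f => convex_cruxWulffBody (A f)
  have hW0 : ∀ f, (0 : E3) ∈ W (A f) := fun f => zero_mem_cruxWulffBody (A f)
  have hWs : ∀ f, -W (A f) = W (A f) := fun f => neg_cruxWulffBody_eq (A f)
  -- the free energy is nonnegative (`Fr ≥ √3·Per(E')`)
  have hFr0 : 0 ≤ ∑ f, (Per (W (A f)) (G f) - ∑ g, (if f = g then 0 else ι (W (A f)) (G f) (G g))) := by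
    have h := freeEnergy_ge_mul_perimeter G hPolyG hvolG hdisjG (fun f => W (A f)) hWc hWv hW0 hWs
      (Real.sqrt_pos.2 (by norm_num : (0:ℝ) < 3)) (fun f => closedBall_subset_cruxWulffBody (A f))
    exact le_trans (mul_nonneg (Real.sqrt_nonneg 3) ENNReal.toReal_nonneg) h
  set V : ℝ := (volume (⋃ f, G f)).toReal with hV
  have hV0 : 0 ≤ V := ENNReal.toReal_nonneg
  set F : ℝ := ∑ f, (Per (W (A f)) (G f) - ∑ g, (if f = g then 0 else ι (W (A f)) (G f) (G g))) with hF
  -- openness / measurability / finiteness of the grains and of `E' = ⋃ G f`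
  have hGo : ∀ f, IsOpen (G f) := by
    intro f
    obtain ⟨kf, H, hGf⟩ := hPolyG f
    rw [hGf]
    exact isOpen_iUnion fun i => isOpen_biInter_finset fun q _ =>
      isOpen_lt (continuous_const.inner continuous_id) continuous_const
  have hGm : ∀ f, MeasurableSet (G f) := fun f => (hGo f).measurableSet
  have hE'top : volume (⋃ f, G f) ≠ ⊤ := by
    refine (lt_of_le_of_lt (measure_iUnion_le _) ?_).ne
    rw [tsum_fintype]
    exact ENNReal.sum_lt_top.2 fun f _ => hvolG f
  by_cases hE'0 : volume (⋃ f, G f) = 0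
  · -- empty texture: the bound is `0 ≤ Fr`
    have hV00 : V = 0 := by rw [hV, hE'0, ENNReal.toReal_zero]
    rw [hV00, mul_zero, Real.zero_rpow (by norm_num), mul_zero]
    exact hFr0
  -- the grains are bounded, hence so are the chimera neighbourhoods
  have hEbd : Bornology.IsBounded (⋃ f, G f) := by
    refine Bornology.isBounded_iUnion.2 fun f => ?_
    obtain ⟨kf, H, hGf⟩ := hPolyG f
    rw [hGf]
    refine Bornology.isBounded_iUnion.2 fun i => isBounded_hPolyhedron_of_volume_lt_top (H i) ?_
    exact lt_of_le_of_lt (measure_mono (by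
      rw [hGf]; exact subset_iUnion (fun i => ⋂ p ∈ H i, {x : E3 | ⟪p.1, x⟫_ℝ < p.2}) i)) (hvolG f)
  -- the chimera neighbourhood of radius `r`
  have key : ∀ ε : ℝ, 0 < ε → 3 * (32 : ℝ) ^ ((3 : ℝ)⁻¹) * (V ^ ((3 : ℝ)⁻¹)) ^ 2 ≤ F + ε := by
    intro ε hε
    obtain ⟨r₀, hr₀, hup⟩ := volume_chimera_texture_le G hPolyG hvolG hdisjG (fun f => W (A f))
      hWc hWv hW0 hWs hε
    set r : ℝ := r₀ / 2 with hr
    have hr0 : 0 < r := by positivity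
    have hrr₀ : r < r₀ := by rw [hr]; linarith
    set C : Set E3 := ⋃ f, ⋃ x ∈ G f, x +ᵥ (r • W (A f)) with hC
    -- `C` is open (a union of translates of the open grains), hence measurable
    have hCopen : IsOpen C := by
      have hCeq : C = ⋃ f, ⋃ w ∈ r • W (A f), (fun x => x + w) '' G f := by
        ext y
        simp only [hC, mem_iUnion, Set.mem_vadd_set, vadd_eq_add, mem_image, exists_prop]
        constructor
        · rintro ⟨f, x, hx, w, hw, rfl⟩; exact ⟨f, w, hw, x, hx, rfl⟩
        · rintro ⟨f, w, hw, x, hx, rfl⟩; exact ⟨f, x, hx, w, hw, rfl⟩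
      rw [hCeq]
      exact isOpen_iUnion fun f => isOpen_biUnion fun w _ => (isOpenMap_add_right w) _ (hGo f)
    have hCm : MeasurableSet C := hCopen.measurableSet
    -- `C` is bounded, hence of finite volume
    have hCfin : volume C ≠ ⊤ := by
      obtain ⟨R₁, hR₁⟩ := hEbd.subset_closedBall 0
      have hCsub : C ⊆ Metric.closedBall (0 : E3) (R₁ + r * Real.sqrt 5) := by
        intro y hy
        simp only [hC, mem_iUnion, Set.mem_vadd_set, vadd_eq_add, exists_prop] at hy
        obtain ⟨f, x, hx, w, hw, rfl⟩ := hy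
        obtain ⟨w', hw', rfl⟩ := Set.mem_smul_set.1 hw
        have hx' : ‖x‖ ≤ R₁ := mem_closedBall_zero_iff.1 (hR₁ (mem_iUnion.2 ⟨f, hx⟩))
        have hw'' : ‖w'‖ ≤ Real.sqrt 5 := mem_closedBall_zero_iff.1 (cruxWulffBody_subset_closedBall (A f) hw')
        rw [mem_closedBall_zero_iff]
        calc ‖x + r • w'‖ ≤ ‖x‖ + ‖r • w'‖ := norm_add_le _ _
          _ = ‖x‖ + r * ‖w'‖ := by rw [norm_smul, Real.norm_of_nonneg hr0.le]
          _ ≤ R₁ + r * Real.sqrt 5 := by gcongr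
      exact (lt_of_le_of_lt (measure_mono hCsub) measure_closedBall_lt_top).ne
    -- lower bound (chimera) and upper bound (Minkowski content)
    have hlow := layer_chimera_lower m n hn hmn G hGm A hAx hlayer hE'0 hE'top hr0 hCm
      (fun f x hx w hw => mem_iUnion.2 ⟨f, mem_iUnion₂.2 ⟨x, hx,
        Set.mem_vadd_set.2 ⟨r • w, Set.smul_mem_smul_set hw, rfl⟩⟩⟩)
    have hupC : (volume C).toReal ≤ V + r * (F + ε) := hup r hr0 hrr₀
    -- to real numbers
    set c : ℝ := (32 : ℝ) ^ ((3 : ℝ)⁻¹) with hc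
    have hc0 : 0 ≤ c := by positivity
    have hexp : (((3 : ℕ) : ℝ)⁻¹) = (3 : ℝ)⁻¹ := by norm_num
    have h1 : V ^ ((3 : ℝ)⁻¹) + r * c ≤ (volume C).toReal ^ ((3 : ℝ)⁻¹) := by
      have h := ENNReal.toReal_mono (ENNReal.rpow_ne_top_of_nonneg (by positivity) hCfin) hlow
      rw [ENNReal.toReal_add (ENNReal.rpow_ne_top_of_nonneg (by positivity) hE'top)
          (ENNReal.mul_ne_top ENNReal.ofReal_ne_top (ENNReal.rpow_ne_top_of_nonneg (by positivity)
            ENNReal.ofReal_ne_top)),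
        ENNReal.toReal_mul, ENNReal.toReal_ofReal hr0.le, ← ENNReal.toReal_rpow, ← ENNReal.toReal_rpow,
        ← ENNReal.toReal_rpow, ENNReal.toReal_ofReal (by norm_num : (0:ℝ) ≤ 32), hexp] at h
      exact h
    -- cube: `(V^{1/3} + r c)³ ≤ |C| ≤ V + r (F + ε)`
    set x : ℝ := V ^ ((3 : ℝ)⁻¹) with hx
    have hx0 : 0 ≤ x := by positivity
    have hx3 : x ^ 3 = V := by
      rw [hx, show ((3 : ℝ)⁻¹) = ((3 : ℕ) : ℝ)⁻¹ by norm_num]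
      exact Real.rpow_inv_natCast_pow hV0 (by norm_num)
    have hC3 : ((volume C).toReal ^ ((3 : ℝ)⁻¹)) ^ 3 = (volume C).toReal := by
      rw [show ((3 : ℝ)⁻¹) = ((3 : ℕ) : ℝ)⁻¹ by norm_num]
      exact Real.rpow_inv_natCast_pow ENNReal.toReal_nonneg (by norm_num)
    have h2 : (x + r * c) ^ 3 ≤ V + r * (F + ε) := by
      calc (x + r * c) ^ 3 ≤ ((volume C).toReal ^ ((3 : ℝ)⁻¹)) ^ 3 := by
            gcongr
        _ = (volume C).toReal := hC3
        _ ≤ V + r * (F + ε) := hupC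
    -- drop the higher-order terms and divide by `r`
    have h3 : r * (3 * c * x ^ 2) ≤ r * (F + ε) := by
      nlinarith [hx3, h2, hx0, hc0, hr0.le, mul_nonneg (mul_nonneg hr0.le hc0) (mul_nonneg hr0.le hc0),
        pow_nonneg (mul_nonneg hr0.le hc0) 3, mul_nonneg hx0 (mul_nonneg (mul_nonneg hr0.le hc0) (mul_nonneg hr0.le hc0))]
    have h4 : 3 * c * x ^ 2 ≤ F + ε := le_of_mul_le_mul_left h3 hr0
    linarith
  rw [wulff_constant_eq hV0]
  exact le_of_forall_pos_le_add key

/-- **Rung `rung_vertical_texture`**: single-axis twin textures (axis `m₀`) whose lattice is a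
function of `⟪x, n⟫` for a horizontal unit vector `n ⊥ m₀` (all twin walls vertical of normal `n`)
satisfy the crux's inequality `6·2^{1/3}(√2·Vol)^{2/3} ≤ En` for arbitrary wall data. -/
theorem rung_vertical_texture :
    let Λ : Set (EuclideanSpace ℝ (Fin 3)) := Literature.MathematicalPhysics.StatisticalMechanics.fccStacking 1 (Real.sqrt (2 / 3));
    let Brl : (ℤ → ℤ) → Set (EuclideanSpace ℝ (Fin 3)) := Literature.MathematicalPhysics.StatisticalMechanics.barlowStacking 1 (Real.sqrt (2 / 3));
    let Ax : EuclideanSpace ℝ (Fin 3) → (EuclideanSpace ℝ (Fin 3) ≃ₗᵢ[ℝ] EuclideanSpace ℝ (Fin 3)) → (EuclideanSpace ℝ (Fin 3) ≃ₗᵢ[ℝ] EuclideanSpace ℝ (Fin 3)) → Prop := fun m A B => ∃ (L : EuclideanSpace ℝ (Fin 3) ≃ₗᵢ[ℝ] EuclideanSpace ℝ (Fin 3)) (s₁ s₂ : EuclideanSpace ℝ (Fin 3)) (σ σ' : ℤ → ℤ), Literature.MathematicalPhysics.StatisticalMechanics.IsHaggSeq σ ∧ Literature.MathematicalPhysics.StatisticalMechanics.IsHaggSeq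 σ' ∧ L (EuclideanSpace.single (2 : Fin 3) (1 : ℝ)) = m ∧ A '' Λ ⊆ (fun q => L q + s₁) '' Brl σ ∧ B '' Λ ⊆ (fun q => L q + s₂) '' Brl σ';
    let CoAx : (EuclideanSpace ℝ (Fin 3) ≃ₗᵢ[ℝ] EuclideanSpace ℝ (Fin 3)) → (EuclideanSpace ℝ (Fin 3) ≃ₗᵢ[ℝ] EuclideanSpace ℝ (Fin 3)) → Prop := fun A B => ∃ m, Ax m A B;
    let Φ : EuclideanSpace ℝ (Fin 3) → ℝ := fun ν => Real.sqrt 2 / 4 * ∑ᶠ w ∈ {w ∈ Λ | ‖w‖ = 1}, |⟪w, ν⟫_ℝ|;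
    let Per : Set (EuclideanSpace ℝ (Fin 3)) → Set (EuclideanSpace ℝ (Fin 3)) → ℝ := fun K S => (⨆ (ξ : EuclideanSpace ℝ (Fin 3) → EuclideanSpace ℝ (Fin 3)) (_ : ContDiff ℝ 1 ξ ∧ HasCompactSupport ξ ∧ ∀ z, ξ z ∈ K), ENNReal.ofReal (∫ z in S, Literature.MathematicalPhysics.StatisticalMechanics.fieldDivergence ξ z)).toReal;
    let ι : Set (EuclideanSpace ℝ (Fin 3)) → Set (EuclideanSpace ℝ (Fin 3)) → Set (EuclideanSpace ℝ (Fin 3)) → ℝ := fun K S₁ S₂ => (Per K S₁ + Per K S₂ - Per K (S₁ ∪ S₂)) / 2;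
    let W : (EuclideanSpace ℝ (Fin 3) ≃ₗᵢ[ℝ] EuclideanSpace ℝ (Fin 3)) → Set (EuclideanSpace ℝ (Fin 3)) := fun A => {y | ∀ ν : EuclideanSpace ℝ (Fin 3), ⟪y, ν⟫_ℝ ≤ Φ (A.symm ν)};
    let Dsc : EuclideanSpace ℝ (Fin 3) → Set (EuclideanSpace ℝ (Fin 3)) := fun m => {y | ‖y‖ ≤ 1 ∧ ⟪y, m⟫_ℝ = 0};
    let Tex : (n : ℕ) → (Fin n → Set (EuclideanSpace ℝ (Fin 3))) → (Fin n → (EuclideanSpace ℝ (Fin 3) ≃ₗᵢ[ℝ] EuclideanSpace ℝ (Fin 3))) → (Fin n → Fin n → ℝ) → (Fin n → Fin n → EuclideanSpace ℝ (Fin 3)) → Prop := fun n G A c m => (∀ f : Fin n, Literature.MathematicalPhysics.StatisticalMechanics.HasFinitePerimeter (G f) ∧ volume (G f) < ⊤) ∧ (∀ f g, f ≠ g → Disjoint (G f) (G g)) ∧ (∀ f g, f ≠ g → 0 ≤ c f g) ∧ (∀ f g, f ≠ g → ¬ CoAx (A f) (A g) → m f g = 0 ∧ 1 ≤ c f g)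 ∧ (∀ f g, f ≠ g → CoAx (A f) (A g) → A f '' Λ ≠ A g '' Λ → Ax (m f g) (A f) (A g) ∧ 1 / 2 ≤ c f g);
    let En : (n : ℕ) → (Fin n → Set (EuclideanSpace ℝ (Fin 3))) → (Fin n → (EuclideanSpace ℝ (Fin 3) ≃ₗᵢ[ℝ] EuclideanSpace ℝ (Fin 3))) → (Fin n → Fin n → ℝ) → (Fin n → Fin n → EuclideanSpace ℝ (Fin 3)) → ℝ := fun n G A c m => ∑ f : Fin n, Per (W (A f)) (G f) - ∑ f, ∑ g, (if f = g then 0 else ι (W (A f)) (G f) (G g)) + ∑ f, ∑ g, (if f = g then 0 else c f g / 2 * ι (Dsc (m f g)) (G f) (G g));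
    let Vol : (n : ℕ) → (Fin n → Set (EuclideanSpace ℝ (Fin 3))) → ℝ := fun n G => (volume (⋃ f : Fin n, G f)).toReal;
    let Poly : Set (EuclideanSpace ℝ (Fin 3)) → Prop := fun S => ∃ (k : ℕ) (H : Fin k → Finset ((EuclideanSpace ℝ (Fin 3)) × ℝ)), S = ⋃ i, ⋂ p ∈ H i, {x | ⟪p.1, x⟫_ℝ < p.2};
    ∀ (n : ℕ) (G : Fin n → Set (EuclideanSpace ℝ (Fin 3))) (A : Fin n → (EuclideanSpace ℝ (Fin 3) ≃ₗᵢ[ℝ] EuclideanSpace ℝ (Fin 3))) (c : Fin n → Fin n → ℝ) (m : Fin n → Fin n → EuclideanSpace ℝ (Fin 3)), Tex n G A c m → (∀ f, Poly (G f)) → ∀ (m₀ n₀ : EuclideanSpace ℝ (Fin 3)), (∀ f g, Ax m₀ (A f) (A g)) → ‖n₀‖ = 1 → ⟪m₀, n₀⟫_ℝ = 0 → (∀ f g, ∀ x ∈ G f, ∀ y ∈ G g, ⟪x, n₀⟫_ℝ = ⟪y, n₀⟫_ℝ → A f '' Λ = A g '' Λ) → 6 * (2 : ℝ) ^ ((1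 : ℝ) / 3) * (Real.sqrt 2 * Vol n G) ^ ((2 : ℝ) / 3) ≤ En n G A c m := by
  intro Λ Brl Ax CoAx Φ Per ι W Dsc Tex En Vol Poly n G A c m hTex hPoly m₀ n₀ hAx hn hmn hlayer
  obtain ⟨hfin, hdisj, hc0, -, -⟩ := hTex
  have hvol : ∀ f, volume (G f) < ⊤ := fun f => (hfin f).2
  have hDc : ∀ v : E3, IsCompact (Dsc v) := fun v =>
    Metric.isCompact_of_isClosed_isBounded
      ((isClosed_le continuous_norm continuous_const).inter
        (isClosed_eq (continuous_id.inner continuous_const) continuous_const))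
      (Metric.isBounded_closedBall.subset (cruxDisc_subset_closedBall v))
  -- the wall terms are nonnegative
  have hwalls : 0 ≤ ∑ f, ∑ g, (if f = g then 0 else c f g / 2 * ι (Dsc (m f g)) (G f) (G g)) := by
    refine Finset.sum_nonneg fun f _ => Finset.sum_nonneg fun g _ => ?_
    by_cases hfg : f = g
    · rw [if_pos hfg]
    · rw [if_neg hfg]
      have hnn := iota_nonneg_of_poly G hPoly hvol hdisj (hDc (m f g)) (convex_cruxDisc (m f g))
        (zero_mem_cruxDisc (m f g)) hfg
      show 0 ≤ c f g / 2 * ((per (Dsc (m f g)) (G f) + per (Dsc (m f g)) (G g) -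
        per (Dsc (m f g)) (G f ∪ G g)) / 2)
      exact mul_nonneg (div_nonneg (hc0 f g hfg) zero_le_two) (div_nonneg hnn zero_le_two)
  -- the free-energy rung
  have hFr : 6 * (2 : ℝ) ^ ((1 : ℝ) / 3) * (Real.sqrt 2 * Vol n G) ^ ((2 : ℝ) / 3) ≤
      ∑ f, Per (W (A f)) (G f) - ∑ f, ∑ g, (if f = g then 0 else ι (W (A f)) (G f) (G g)) :=
    rung_vertical n G A m₀ n₀ hPoly hvol hdisj hAx hn hmn hlayer
  show 6 * (2 : ℝ) ^ ((1 : ℝ) / 3) * (Real.sqrt 2 * Vol n G) ^ ((2 : ℝ) / 3) ≤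
    ∑ f, Per (W (A f)) (G f) - ∑ f, ∑ g, (if f = g then 0 else ι (W (A f)) (G f) (G g)) +
      ∑ f, ∑ g, (if f = g then 0 else c f g / 2 * ι (Dsc (m f g)) (G f) (G g))
  linarith

end Summit.Ventures.Crystal3D.Cruxes.PolycrystalWulffBound.PolyDensity

end
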